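import Mathlib
import HarnessLib
import Literature.NumberTheory.Automorphic.AutomorphicRepsGL2WeightOneCleanModel
import Literature.NumberTheory.Automorphic.StrongArtinCentralCharacter
import Literature.NumberTheory.Automorphic.AutomorphicRepsGLSatakeFlathProofs
import Literature.NumberTheory.Automorphic.NewformAdelisation
import Literature.NumberTheory.Automorphic.NewformAdelisationHeckeCosets
import Summits.Langlands.Langlands.Theorems.QuarterDeficit1951CorrespondentFingerprintStubGlueEvenLadder
import Summits.Langlands.Langlands.Theorems.QuarterDeficit1951CorrespondentFingerprintStubGlueTransfer

/-!
# Glue stub `stub_glue` — crux stmt-Langlands-15898 `QuarterDeficit1951.CorrespondentFingerprint`,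
line `Sketch` (lead prover-line-stmt-Langlands-15898-0)

One clean, level-structured, weight-zero vector.  Input (all modulo `W'`, on an arbitrary cuspidal
Borel–Jacquet datum `π = W / W'` of `GL₂(𝔸_ℚ)`): central character `ψ_{χ₁}` (`χ₁` a Dirichlet
character mod `N`), the archimedean `-1` acting trivially, archimedean Harish-Chandra parameter
`{a, -a}` (`a ∈ ℤ`), and a `K₁(N)`-fixed vector.  Output: a non-zero cusp form `φ₀` in the clean
model `C / ⊥ ≅ W / W'` (`AutomorphicRepsGLShiftRealisation`) which is EXACTLY `K₁(N)`-fixed, of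
central character `ψ_{χ₁}`, `A_G`-invariant, archimedean-smooth, of `SO(2)`-weight `0`, killed by
`Z`, with `Ω φ₀ = (2a² - 1/2) φ₀`, and an eigenvector of the unramified Hecke operators `T_{v,1}`,
`T_{v,2}` (`v ∤ N`) with the Satake eigenvalues of `π`.

* transfer of congruences `r(g) x - λ x ∈ W'` to identities on `C` (`shift_sub_smul_eq_zero`), and
  of a `K₁(N)`-fixed vector modulo `W'` to an exactly fixed vector of `C` (`shift_exists_fixed`,
  through the isomorphism `C / ⊥ ≅ W / W'`);
* ideles of `ℚ`: `z = (z_∞, 1)(1, z_f)`, `z_∞ = sgn(z_∞) |z_∞|`, and the corresponding central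
  elements `r(z 1₂)` of `GL₂(𝔸_ℚ)` (`infI_eq_infIdele`, `infIdele_eq_posRealIdele`, `scalar_finI_eq_ofFinite`);
* the even `SO(2)`-ladder (`stub_glue_evenLadder`, file `…StubGlueEvenLadder`);
* Hecke exactness on `K(N)`-fixed vectors of a clean datum
  (`Flath1979_heckeOperator_ofLocal_sub_smul_mem_holds`) and the identification of the eigenvalues
  with the Satake parameter of `π` (`hasSatakeParamAt_unique_holds`).
-/

set_option linter.dupNamespace false

noncomputable section

open scoped MatrixGroups Matrix NumberField NNReal Classical
open Literature.NumberTheory.Automorphic Literature.NumberTheory.GaloisRepresentations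
  IsDedekindDomain NumberField NumberField.mixedEmbedding
open Literature.NumberTheory.Automorphic.GL2Real
open Rat.HeightOneSpectrum

namespace Summit.Langlands.Langlands.Theorems.CorrespondentFingerprint

section Glue

variable {hcpt : isCompact_glFiniteIntegralLevel 2 ℚ}

/-- The finite idele `(1, z_f)` of `z = (z_∞, z_f)` (local notation). -/
local notation3 "finI " z:max => (@Units.map (FiniteAdeleRing (𝓞 ℚ) ℚ) (AdeleRing (𝓞 ℚ) ℚ) _ _
    (MonoidHom.inr (InfiniteAdeleRing ℚ) (FiniteAdeleRing (𝓞 ℚ) ℚ)) (ideleGroup.finPart ℚ z) : ideleGroup ℚ)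
/-- The infinite idele `(z_∞, 1)` of `z` (local notation). -/
local notation3 "infI " z:max =>
  (infiniteIdeles ℚ (Units.map (RingHom.fst (InfiniteAdeleRing ℚ) (FiniteAdeleRing (𝓞 ℚ) ℚ)).toMonoidHom z) : ideleGroup ℚ)

/-- **STUB `stub_glue`** (one vector; registered signature). [cite: Gelbart1997, Prop. 2.5 and Remark 2.5.5]
[cite: BorelJacquetCorvallis1979, §4.6 and 5.7] [cite: Bump1997, §2.5] -/
theorem stub_glue : ∀ (hcpt : isCompact_glFiniteIntegralLevel 2 ℚ)
    (π : CuspidalAutomorphicRepData 2 ℚ hcpt) (N : ℕ) [NeZero N] (χ₁ : DirichletCharacter ℂ N) (a : ℤ),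
    (∀ (z : ideleGroup ℚ), ∀ φ ∈ π.1.W,
      rightTranslation (AdelicGroupData.gl 2 ℚ) (Matrix.GeneralLinearGroup.scalar (Fin 2) z) φ -
        ((HeckeCharacter.ofDirichlet χ₁ z : ℂˣ) : ℂ) • φ ∈ π.1.W') →
    (∀ φ ∈ π.1.W, rightTranslation (AdelicGroupData.gl 2 ℚ)
        ((AutomorphyDatum.gl 2 ℚ hcpt).ofArch ⟨-1, trivial⟩) φ - φ ∈ π.1.W') →
    π.1.HasArchParameter (fun _ => ({(a : ℂ), -(a : ℂ)} : Multiset ℂ)) →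
    (∃ φ ∈ π.1.W, φ ∉ π.1.W' ∧
      ∀ u ∈ gammaOneFiniteLevel ℚ (Ideal.span {(N : 𝓞 ℚ)}),
        rightTranslation (AdelicGroupData.gl 2 ℚ)
            (show (AdelicGroupData.gl 2 ℚ).Adelic from GLn.ofFinite 2 ℚ u) φ - φ ∈ π.1.W') →
    ∃ φ₀ : (AdelicGroupData.gl 2 ℚ).Adelic → ℂ,
      φ₀ ∈ cuspFormsGL 2 ℚ hcpt ∧ φ₀ ≠ 0 ∧
      (∀ u ∈ gammaOneFiniteLevel ℚ (Ideal.span {(N : 𝓞 ℚ)}),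
        rightTranslation (AdelicGroupData.gl 2 ℚ)
            (show (AdelicGroupData.gl 2 ℚ).Adelic from GLn.ofFinite 2 ℚ u) φ₀ = φ₀) ∧
      (∀ z : ideleGroup ℚ,
        rightTranslation (AdelicGroupData.gl 2 ℚ) (Matrix.GeneralLinearGroup.scalar (Fin 2) z) φ₀ =
          ((HeckeCharacter.ofDirichlet χ₁ z : ℂˣ) : ℂ) • φ₀) ∧
      (∀ z ∈ (AdelicGroupData.gl 2 ℚ).center', ∀ g, φ₀ (z * g) = φ₀ g) ∧
      IsArchSmooth Rat.iotaA φ₀ ∧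
      IsWeightVec Rat.iotaA 0 φ₀ ∧
      lieDeriv Rat.iotaA (toLie 1) φ₀ = 0 ∧
      casimirFun Rat.iotaA φ₀ = ((2 * (a : ℝ) ^ 2 - 1 / 2 : ℝ) : ℂ) • φ₀ ∧
      ∀ v : HeightOneSpectrum (𝓞 ℚ), ¬ v.asIdeal ∣ Ideal.span {(N : 𝓞 ℚ)} →
        ∀ α : Multiset ℂ, π.1.HasSatakeParamAt v α →
          heckeOperator (rightTranslation (AdelicGroupData.gl 2 ℚ))
              (show Subgroup (AdelicGroupData.gl 2 ℚ).Adelic from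
                principalCongruenceLevel 2 ℚ (Ideal.span {(N : 𝓞 ℚ)}))
              (heckeDiagAt 2 ℚ v (Rat.localUniformizer v) 1) φ₀ =
            ((((Real.sqrt (v.residueCard : ℝ)) : ℝ) : ℂ) * α.esymm 1) • φ₀ ∧
          heckeOperator (rightTranslation (AdelicGroupData.gl 2 ℚ))
              (show Subgroup (AdelicGroupData.gl 2 ℚ).Adelic from
                principalCongruenceLevel 2 ℚ (Ideal.span {(N : 𝓞 ℚ)}))
              (heckeDiagAt 2 ℚ v (Rat.localUniformizer v) 2) φ₀ = (α.esymm 2) • φ₀ := by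
  intro hcpt π N _ χ₁ a hcen heven harch hfix
  set ψ := HeckeCharacter.ofDirichlet χ₁ with hψ_def
  -- (1) the clean model
  obtain ⟨π₀, μ, j, M, h⟩ :=
    π.exists_isShiftRealisation_of_sSup_irreducible AutomorphicRepsGL.stable_cuspidal_eq_sSup_irreducible_holds
  have hbot := h.bot
  have harch₀ : π₀.1.HasArchParameter (fun _ => ({(a : ℂ), -(a : ℂ)} : Multiset ℂ)) := h.hasArchParameter harch
  -- (2) `Z = 0` on `C`, hence `μ = 0` and `A_G`-invariance
  have hZ : ∀ c ∈ π₀.1.W, lieDeriv Rat.iotaA (toLie 1) c = 0 := fun c hc => by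
    have h1 := π₀.1.lieDeriv_one_sub_smul_mem harch₀ hc
    rw [hbot, Submodule.mem_bot, add_neg_cancel, zero_smul, sub_zero] at h1
    exact h1
  have hμ : μ = 0 := by
    obtain ⟨c, hcW, hc0⟩ := Submodule.exists_mem_ne_zero_of_ne_bot h.W_ne_bot
    have h1 := h.lieDeriv_one_eq_smul hcW
    rw [← Rat.lieOfReal_one (hcpt := hcpt), Rat.lieDeriv_ofArch_lieOfReal_eq, hZ c hcW] at h1
    rcases smul_eq_zero.1 h1.symm with h2 | h2
    · exact h2
    · exact absurd h2 hc0
  have hAG : ∀ c ∈ π₀.1.W, ∀ z ∈ (AdelicGroupData.gl 2 ℚ).center', ∀ g, c (z * g) = c g :=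
    fun c hc => h.apply_center'_mul hμ hc
  -- (3) the Casimir scalar on `C`
  have hcas : ∀ c ∈ π₀.1.W, casimirFun Rat.iotaA c = ((2 * (a : ℝ) ^ 2 - 1 / 2 : ℝ) : ℂ) • c := by
    intro c hc
    have hsm : IsArchSmooth Rat.iotaA c := (π₀.1.isArchSmooth_of_mem_W hc).iotaA
    have h1 := π₀.1.sum_lieDeriv_single_sub_smul_mem harch₀ hc
    rw [hbot, Submodule.mem_bot, sub_eq_zero] at h1
    have hid := GL2Real.casimirFun_add_half_zz hsm
    rw [hZ c hc, lieDeriv_zero_right, smul_zero, add_zero] at hid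
    rw [hid, h1]
    congr 1
    push_cast
    ring
  -- (4) the sign: `-1_∞` acts trivially on `C`
  have hnegC : ∀ c ∈ π₀.1.W, rightTranslation (AdelicGroupData.gl 2 ℚ)
      ((AutomorphyDatum.gl 2 ℚ hcpt).ofArch ⟨-1, trivial⟩) c = c := by
    intro c hc
    have h1 := shift_sub_smul_eq_zero h ((AutomorphyDatum.gl 2 ℚ hcpt).ofK ⟨-1, neg_one_mem_maximalCompact⟩) 1
      (fun x hx => π.1.stable.k_stable _ hx) (fun x hx => h.stableM.k_stable _ hx)
      (fun x hx => π₀.1.stable.k_stable _ hx) (fun x hx => by rw [one_smul]; exact heven x hx) hc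
    rw [one_smul] at h1
    exact h1
  have hpos : ∀ c ∈ π₀.1.W, ∀ g, c (g * Rat.iotaA (rotK Real.pi)) = c g := by
    intro c hc g
    have h1 := congrFun (hnegC c hc) g
    rw [rightTranslation_apply, ← Rat.iotaA_rotK_pi (hcpt := hcpt)] at h1
    exact h1
  -- (5) the level vector in `C`
  set S : Set (AdelicGroupData.gl 2 ℚ).Adelic :=
    (fun u => (show (AdelicGroupData.gl 2 ℚ).Adelic from GLn.ofFinite 2 ℚ u)) ''
      (gammaOneFiniteLevel ℚ (Ideal.span {(N : 𝓞 ℚ)}) : Set (GL (Fin 2) (FiniteAdeleRing (𝓞 ℚ) ℚ))) with hS_def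
  have hSfin : ∀ u ∈ S, u ∈ (AutomorphyDatum.gl 2 ℚ hcpt).finiteAdelic := by
    rintro _ ⟨u, -, rfl⟩
    exact ⟨u, rfl⟩
  have hfixS : ∃ φ ∈ π.1.W, φ ∉ π.1.W' ∧ ∀ u ∈ S, rightTranslation (AdelicGroupData.gl 2 ℚ) u φ - φ ∈ π.1.W' := by
    obtain ⟨φ, hφW, hφW', hφ⟩ := hfix
    refine ⟨φ, hφW, hφW', ?_⟩
    rintro _ ⟨u, hu, rfl⟩
    exact hφ u hu
  obtain ⟨c₁, hc₁W, hc₁0, hc₁fix⟩ := shift_exists_fixed h S hSfin hfixS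
  -- the subspace `W₁` of `K₁(N)`-fixed vectors of `C`
  let W₁ : Submodule ℂ ((AdelicGroupData.gl 2 ℚ).Adelic → ℂ) :=
    { carrier := {c | c ∈ π₀.1.W ∧ ∀ u ∈ gammaOneFiniteLevel ℚ (Ideal.span {(N : 𝓞 ℚ)}),
        rightTranslation (AdelicGroupData.gl 2 ℚ) (show (AdelicGroupData.gl 2 ℚ).Adelic from GLn.ofFinite 2 ℚ u) c = c}
      add_mem' := fun {x y} hx hy => ⟨add_mem hx.1 hy.1, fun u hu => by rw [map_add, hx.2 u hu, hy.2 u hu]⟩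
      zero_mem' := ⟨zero_mem _, fun u _ => map_zero _⟩
      smul_mem' := fun r x hx => ⟨Submodule.smul_mem _ r hx.1, fun u hu => by rw [map_smul, hx.2 u hu]⟩ }
  have hW₁mem : ∀ c, c ∈ W₁ ↔ c ∈ π₀.1.W ∧ ∀ u ∈ gammaOneFiniteLevel ℚ (Ideal.span {(N : 𝓞 ℚ)}),
      rightTranslation (AdelicGroupData.gl 2 ℚ) (show (AdelicGroupData.gl 2 ℚ).Adelic from GLn.ofFinite 2 ℚ u) c = c :=
    fun c => Iff.rfl
  have hW₁ : W₁ ≤ π₀.1.W := fun c hc => ((hW₁mem c).1 hc).1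
  have hc₁W₁ : c₁ ∈ W₁ := (hW₁mem c₁).2 ⟨hc₁W, fun u hu => hc₁fix _ ⟨u, hu, rfl⟩⟩
  -- the archimedean and finite-adelic factors commute
  have hcomm : ∀ (x : (RealMatrixGroup.gl ℝ (Fin 2)).carrier) (u : GL (Fin 2) (FiniteAdeleRing (𝓞 ℚ) ℚ)),
      Rat.iotaA x * (show (AdelicGroupData.gl 2 ℚ).Adelic from GLn.ofFinite 2 ℚ u) =
        (show (AdelicGroupData.gl 2 ℚ).Adelic from GLn.ofFinite 2 ℚ u) * Rat.iotaA x := fun x u =>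
    Rat.ofRealGL_mul_ofFinite_comm 2 (x : GL (Fin 2) ℝ) u
  have harchW₁ : ∀ (x : (RealMatrixGroup.gl ℝ (Fin 2)).carrier) (c : (AdelicGroupData.gl 2 ℚ).Adelic → ℂ),
      c ∈ W₁ → archTranslate Rat.iotaA x c ∈ π₀.1.W → archTranslate Rat.iotaA x c ∈ W₁ := by
    intro x c hc hmem
    refine (hW₁mem _).2 ⟨hmem, fun u hu => ?_⟩
    funext g
    rw [rightTranslation_apply, archTranslate_apply, archTranslate_apply, mul_assoc, ← hcomm x u, ← mul_assoc]
    exact congrFun (((hW₁mem c).1 hc).2 u hu) (g * Rat.iotaA x)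
  have heps : ∀ c ∈ W₁, archTranslate Rat.iotaA epsK c ∈ W₁ := fun c hc =>
    harchW₁ epsK c hc (π₀.1.archTranslate_iotaA_epsK_mem (hW₁ hc))
  have hrot : ∀ θ : ℝ, ∀ c ∈ W₁, archTranslate Rat.iotaA (rotK θ) c ∈ W₁ := fun θ c hc =>
    harchW₁ (rotK θ) c hc (π₀.1.archTranslate_iotaA_rotK_mem (hW₁ hc) θ)
  have hlie : ∀ (X : Matrix (Fin 2) (Fin 2) ℝ), ∀ c ∈ W₁, lieDeriv Rat.iotaA (toLie X) c ∈ W₁ := by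
    intro X c hc
    refine (hW₁mem _).2 ⟨π₀.1.lieDeriv_iotaA_mem (hW₁ hc) X, fun u hu => ?_⟩
    have hfixc := ((hW₁mem c).1 hc).2 u hu
    have e : rightTranslation (AdelicGroupData.gl 2 ℚ) (show (AdelicGroupData.gl 2 ℚ).Adelic from GLn.ofFinite 2 ℚ u)
        (lieDeriv Rat.iotaA (toLie X) c) =
        fun g => lieDeriv Rat.iotaA (toLie X) c (g * (show (AdelicGroupData.gl 2 ℚ).Adelic from GLn.ofFinite 2 ℚ u)) := rfl
    have e' : (fun g => c (g * (show (AdelicGroupData.gl 2 ℚ).Adelic from GLn.ofFinite 2 ℚ u))) = c := hfixc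
    rw [e, ← lieDeriv_comp_mul_right Rat.iotaA (toLie X) c (fun x => hcomm x u), e']
  have hsmoothW₁ : ∀ c ∈ W₁, IsArchSmooth Rat.iotaA c := fun c hc => (π₀.1.isArchSmooth_of_mem_W (hW₁ hc)).iotaA
  -- (6) the even ladder: a weight-zero vector `φ₀ ∈ W₁ ∖ 0`
  obtain ⟨φ₀, hφ₀W₁, hφ₀0, hw0⟩ := stub_glue_evenLadder W₁ _ hsmoothW₁ heps hlie (fun c hc => hcas c (hW₁ hc))
    (two_mul_casimir_sub_ne_zero a) (fun c hc g => hpos c (hW₁ hc) g) c₁ hc₁0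
    (π₀.1.exists_finiteDimensional_rotation_span hW₁ hrot hc₁W₁)
  have hφ₀W : φ₀ ∈ π₀.1.W := hW₁ hφ₀W₁
  have hφ₀fix := ((hW₁mem φ₀).1 hφ₀W₁).2
  -- (7) the central character on `C`
  have hcenC : ∀ z : ideleGroup ℚ,
      rightTranslation (AdelicGroupData.gl 2 ℚ) (Matrix.GeneralLinearGroup.scalar (Fin 2) z) φ₀ = ((ψ z : ℂˣ) : ℂ) • φ₀ := by
    intro z
    -- finite part
    have hfinmem : (show (AdelicGroupData.gl 2 ℚ).Adelic from
        Matrix.GeneralLinearGroup.scalar (Fin 2) ((finI z))) ∈ (AutomorphyDatum.gl 2 ℚ hcpt).finiteAdelic := by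
      refine ⟨Matrix.GeneralLinearGroup.scalar (Fin 2) (ideleGroup.finPart ℚ z), ?_⟩
      exact (scalar_finI_eq_ofFinite z).symm
    have hfinC : rightTranslation (AdelicGroupData.gl 2 ℚ) (Matrix.GeneralLinearGroup.scalar (Fin 2) ((finI z))) φ₀ =
        ((ψ ((finI z)) : ℂˣ) : ℂ) • φ₀ :=
      shift_sub_smul_eq_zero h _ _ (fun x hx => π.1.stable.finite_stable _ hfinmem hx)
        (fun x hx => h.stableM.finite_stable _ hfinmem hx) (fun x hx => π₀.1.stable.finite_stable _ hfinmem hx)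
        (fun x hx => hcen ((finI z)) x hx) hφ₀W
    -- positive real scalars act trivially, `ψ` is trivial on them
    have hposC : ∀ t : ℝ≥0ˣ, rightTranslation (AdelicGroupData.gl 2 ℚ)
        (Matrix.GeneralLinearGroup.scalar (Fin 2) (posRealIdele ℚ t)) φ₀ = φ₀ := by
      intro t
      funext g
      rw [rightTranslation_apply, ← scalar_mul_comm_adelic]
      exact hAG φ₀ hφ₀W _ ⟨t, rfl⟩ g
    have hψpos : ∀ t : ℝ≥0ˣ, ψ (posRealIdele ℚ t) = 1 := fun t =>
      HeckeCharacter.map_posRealIdele_of_isFiniteOrder (HeckeCharacter.isFiniteOrder_ofDirichlet χ₁) t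
    -- `(-1)_∞ · 1₂ = ofArch(-1) ∈ K_∞` acts on `C` by `ψ((-1)_∞)`
    have hneg1 : rightTranslation (AdelicGroupData.gl 2 ℚ)
        (Matrix.GeneralLinearGroup.scalar (Fin 2) (Rat.infIdele (-1) : ideleGroup ℚ)) φ₀ =
        ((ψ (Rat.infIdele (-1)) : ℂˣ) : ℂ) • φ₀ := by
      have h1 := shift_sub_smul_eq_zero h ((AutomorphyDatum.gl 2 ℚ hcpt).ofK ⟨-1, neg_one_mem_maximalCompact⟩)
        ((ψ (Rat.infIdele (-1)) : ℂˣ) : ℂ)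
        (fun x hx => π.1.stable.k_stable _ hx) (fun x hx => h.stableM.k_stable _ hx)
        (fun x hx => π₀.1.stable.k_stable _ hx) (fun x hx => ?_) hφ₀W
      · have e2 : (AutomorphyDatum.gl 2 ℚ hcpt).ofK ⟨-1, neg_one_mem_maximalCompact⟩ =
            (AutomorphyDatum.gl 2 ℚ hcpt).ofArch ⟨-1, trivial⟩ := rfl
        rw [e2, ofArch_neg_one_eq_scalar_infIdele] at h1
        exact h1
      · change rightTranslation (AdelicGroupData.gl 2 ℚ) ((AutomorphyDatum.gl 2 ℚ hcpt).ofArch ⟨-1, trivial⟩) x - _ ∈ _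
        rw [ofArch_neg_one_eq_scalar_infIdele]
        exact hcen (Rat.infIdele (-1)) x hx
    -- infinite part: `z_∞ = sgn(z_∞) · |z_∞|`
    have hinfC : rightTranslation (AdelicGroupData.gl 2 ℚ) (Matrix.GeneralLinearGroup.scalar (Fin 2) ((infI z))) φ₀ =
        ((ψ ((infI z)) : ℂˣ) : ℂ) • φ₀ := by
      rw [infI_eq_infIdele]
      rcases lt_or_gt_of_ne (Rat.infReal_ne_zero z) with hneg | hposr
      · have habs : 0 < -Rat.infReal z := by linarith
        have e : Units.mk0 (Rat.infReal z) (Rat.infReal_ne_zero z) = (-1 : ℝˣ) * Units.mk0 (-Rat.infReal z) habs.ne' := by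
          refine Units.ext ?_
          simp
        rw [e, map_mul, rightTranslation_scalar_mul, map_mul, infIdele_eq_posRealIdele habs, hposC, hψpos, mul_one,
          hneg1]
      · rw [infIdele_eq_posRealIdele hposr, hposC, hψpos, Units.val_one, one_smul]
    -- assemble `z = (z_∞, 1)(1, z_f)`
    have hz := infI_mul_finI z
    calc rightTranslation (AdelicGroupData.gl 2 ℚ) (Matrix.GeneralLinearGroup.scalar (Fin 2) z) φ₀
        = rightTranslation (AdelicGroupData.gl 2 ℚ)
            (show (AdelicGroupData.gl 2 ℚ).Adelic from
              Matrix.GeneralLinearGroup.scalar (Fin 2) ((infI z) * (finI z))) φ₀ := by rw [hz]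
      _ = ((ψ ((infI z)) : ℂˣ) : ℂ) • ((ψ ((finI z)) : ℂˣ) : ℂ) • φ₀ := by
          rw [rightTranslation_scalar_mul, hfinC, map_smul, hinfC, smul_comm]
      _ = ((ψ z : ℂˣ) : ℂ) • φ₀ := by
          rw [smul_smul, ← Units.val_mul, ← map_mul, hz]
  -- (8) `K(N)`-invariance and the Hecke eigenvalues
  have hfixK : ∀ u ∈ principalCongruenceLevel 2 ℚ (Ideal.span {(N : 𝓞 ℚ)}),
      rightTranslation (AdelicGroupData.gl 2 ℚ) u φ₀ = φ₀ := by
    intro u hu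
    have e : u = GLn.ofFinite 2 ℚ (GLn.sndHom 2 ℚ u) :=
      (GLn.ofFinite_sndHom_of_mem (principalCongruenceLevel_le 2 ℚ _ hu)).symm
    rw [e]
    exact hφ₀fix _ (Rat.sndHom_mem_gammaOneFiniteLevel_of_mem_principalCongruenceLevel hu)
  refine ⟨φ₀, π₀.2 hφ₀W, hφ₀0, hφ₀fix, hcenC, fun z hz g => hAG φ₀ hφ₀W z hz g, hsmoothW₁ φ₀ hφ₀W₁, hw0,
    hZ φ₀ hφ₀W, hcas φ₀ hφ₀W, fun v hv α hα => ?_⟩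
  obtain ⟨β, hsat₀, h1, h2⟩ := exists_hasSatakeParamAt_hecke_eq π₀.1 hbot hv hφ₀W hφ₀0 hfixK
  have hαβ : α = β := AutomorphicRepData.hasSatakeParamAt_unique_holds π.1 hα (h.hasSatakeParamAt hsat₀)
  subst hαβ
  exact ⟨h1, h2⟩

end Glue

end Summit.Langlands.Langlands.Theorems.CorrespondentFingerprint

end
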